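import Summits.AnomalousDissipation.AnomalousDissipation.Theorems.DenseLoudDesignerForces.Negative.FalseWithoutConvection

/-!
# Negative knowledge for the crux `DenseLoudDesignerForces` (stmt-AnomalousDissipation-1143), VI: witness anatomy

Certified copy of §8 of the cdisprove work file: quantitative floors every loud witness must meet — enstrophy
floor `τ⁻¹∫₀^τ‖∇u‖₂² ≥ ε/ν`, power floor `τ⁻¹∫∫⟪f_c,u⟫ ≥ ε`, the exact force-mass identity
`∫‖f_c‖² = R - ντ⁻¹∫∫⟪u,Δf_c⟫` with the mean Reynolds work `R = -τ⁻¹∫₀^τ∫⟪u,(u·∇)f_c⟫`, and the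
REYNOLDS-WORK FLOOR `R ≥ ε²/E - (ν/2)(E + Λ₂(c)²)`.  Supports stmt-AnomalousDissipation-1143.
-/

noncomputable section

namespace Summit.AnomalousDissipation.AnomalousDissipation.Theorems.DenseLoudDesignerForces.Negative

open scoped BigOperators Topology ENNReal InnerProductSpace
open Filter Set MeasureTheory UnitAddTorus
open Literature.Analysis.FunctionSpaces Literature.Analysis.FluidPDE
open Summit.AnomalousDissipation.AnomalousDissipation.Theses.BaireTransfer

/-! ## §8 Witness anatomy: what a loud orbit must do (quantitative targets for constructions)

For the witness `(ν, τ, u, p)` of a point `c ∈ LOUD_j(S,E,ε)`: (i) ENSTROPHY FLOOR `τ⁻¹∫₀^τ‖∇u‖₂² ≥ ε/ν > ε(j+1)`;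
(ii) POWER FLOOR `τ⁻¹∫₀^τ∫⟪f_c,u⟫ ≥ ε` (the forced modes of `u` stay correlated with the force); (iii) REYNOLDS-WORK
FLOOR: the mean work of the Reynolds stress against the strain of the force,
`R := τ⁻¹∫₀^τ∫⟪(u·∇)u, f_c⟫ = -τ⁻¹∫₀^τ∫⟪u,(u·∇)f_c⟫`, satisfies `∫‖f_c‖² = R - ν τ⁻¹∫₀^τ∫⟪u,Δf_c⟫` exactly and
`R ≥ ε²/E - (ν/2)(E + Λ₂(c)²)`: at small `ν` the force's whole `L²` mass is sustained by nonlinear transfer.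
A construction must deliver periodic orbits whose triple correlation with the (explicit, low-mode) strain field
`Df_c` is of order `‖f_c‖²₂`, uniformly in the level. -/

section Anatomy

variable {S : Finset (Fin 3 → ℤ)} {E ε ν τ : ℝ} {c : ↥S → (EuclideanSpace ℂ (Fin 3))} {u : ℝ → (UnitAddTorus (Fin 3)) → (EuclideanSpace ℝ (Fin 3))} {p : ℝ → (UnitAddTorus (Fin 3)) → ℝ}

/-- ENSTROPHY FLOOR: a loud witness has period-mean enstrophy `τ⁻¹∫₀^τ‖∇u‖₂² ≥ ε/ν`. -/
theorem mean_gradNormSq_ge (hsol : Torus.IsClassicalNSSolutionOn univ ν (fun _ => force S c) u p)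
    (hν : 0 < ν) (hper : Function.Periodic u τ) (hτ : 0 < τ) (hε : ε ≤ meanDissipation ν u) :
    ε / ν ≤ τ⁻¹ * ∫ t in (0 : ℝ)..τ, Torus.gradNormSq (u t) := by
  rw [meanDissipation_eq_period_mean hsol.smooth_velocity hper hτ] at hε
  rw [div_le_iff₀ hν]
  linarith [mul_comm ν (τ⁻¹ * ∫ t in (0 : ℝ)..τ, Torus.gradNormSq (u t))]

/-- … in particular `> ε(j+1)` at level `j` (for `ε ≥ 0`). -/
theorem mean_gradNormSq_gt_level (hsol : Torus.IsClassicalNSSolutionOn univ ν (fun _ => force S c) u p)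
    (hν : 0 < ν) {j : ℕ} (hνj : ν < 1 / ((j : ℝ) + 1)) (hper : Function.Periodic u τ) (hτ : 0 < τ)
    (hε0 : 0 ≤ ε) (hε : ε ≤ meanDissipation ν u) :
    ε * ((j : ℝ) + 1) ≤ τ⁻¹ * ∫ t in (0 : ℝ)..τ, Torus.gradNormSq (u t) := by
  refine le_trans ?_ (mean_gradNormSq_ge hsol hν hper hτ hε)
  rw [le_div_iff₀ hν]
  have hj : (0 : ℝ) < (j : ℝ) + 1 := by positivity
  have h1 : ν * ((j : ℝ) + 1) ≤ 1 := by
    have := hνj.le; rwa [le_div_iff₀ hj] at this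
  nlinarith

/-- POWER FLOOR: `ε ≤ τ⁻¹∫₀^τ∫⟪f_c, u⟫` for a loud witness. -/
theorem meanPower_ge (hsol : Torus.IsClassicalNSSolutionOn univ ν (fun _ => force S c) u p)
    (hper : Function.Periodic u τ) (hτ : 0 < τ) (hε : ε ≤ meanDissipation ν u) :
    ε ≤ τ⁻¹ * ∫ t in (0 : ℝ)..τ, ∫ x, ⟪force S c x, u t x⟫_ℝ := by
  rwa [meanDissipation_eq_meanPower hsol hper hτ] at hε

/-- The mean REYNOLDS WORK of a periodic orbit against the strain of the designer force:
`R = -τ⁻¹ ∫₀^τ ∫⟪u, (u·∇)f_c⟫ (= τ⁻¹∫₀^τ∫⟪(u·∇)u, f_c⟫` by antisymmetry). -/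
def reynoldsWork (S : Finset (Fin 3 → ℤ)) (c : ↥S → (EuclideanSpace ℂ (Fin 3))) (τ : ℝ) (u : ℝ → (UnitAddTorus (Fin 3)) → (EuclideanSpace ℝ (Fin 3))) : ℝ :=
  -(τ⁻¹ * ∫ t in (0 : ℝ)..τ, ∫ x, ⟪u t x, Torus.convect (u t) (force S c) x⟫_ℝ)

/-- EXACT FORCE-MASS IDENTITY: `∫‖f_c‖² = R - ν τ⁻¹∫₀^τ∫⟪u, Δf_c⟫` for every periodic classical orbit forced by
`f_c` (momentum period identity with `φ = f_c`). -/
theorem forceEnergy_eq_reynoldsWork_sub (hsol : Torus.IsClassicalNSSolutionOn univ ν (fun _ => force S c) u p)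
    (hper : Function.Periodic u τ) (hτ : 0 < τ) :
    ∫ x, ‖force S c x‖ ^ 2 =
      reynoldsWork S c τ u - ν * (τ⁻¹ * ∫ t in (0 : ℝ)..τ, ∫ x, ⟪u t x, Torus.laplacian (force S c) x⟫_ℝ) := by
  have hid := momentum_period_identity hsol (isSmooth_force S c) (isDivFree_force S c) hper
  have heq : ∫ x, ⟪force S c x, force S c x⟫_ℝ = ∫ x, ‖force S c x‖ ^ 2 :=
    integral_congr_ae (ae_of_all _ fun x => real_inner_self_eq_norm_sq _)
  rw [heq] at hid
  unfold reynoldsWork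
  have hτne : τ ≠ 0 := hτ.ne'
  field_simp
  linarith

/-- REYNOLDS-WORK FLOOR: a loud witness with budgets `(E, ε)`, `ε > 0`, satisfies
`R ≥ ε²/E - (ν/2)(E + Λ₂(c)²)`. -/
theorem reynoldsWork_ge (hsol : Torus.IsClassicalNSSolutionOn univ ν (fun _ => force S c) u p)
    (hν : 0 < ν) (hper : Function.Periodic u τ) (hτ : 0 < τ) (hε : 0 < ε)
    (hEu : meanEnergy u ≤ E) (hεu : ε ≤ meanDissipation ν u) :
    ε ^ 2 / E - ν / 2 * (E + lapBound S c ^ 2) ≤ reynoldsWork S c τ u := by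
  have hu := hsol.smooth_velocity
  have hF := isSmooth_force S c
  have hmE := meanEnergy_nonneg' hper hτ
  have hA : 0 ≤ ∫ x, ‖force S c x‖ ^ 2 := integral_nonneg fun _ => sq_nonneg _
  -- power budget `ε² ≤ (∫‖f_c‖²)·E`, and `E > 0`
  have hpow : ε ^ 2 ≤ (∫ x, ‖force S c x‖ ^ 2) * meanEnergy u :=
    calc ε ^ 2 ≤ meanDissipation ν u ^ 2 := by gcongr
      _ ≤ (∫ x, ‖force S c x‖ ^ 2) * meanEnergy u := meanDissipation_sq_le hsol hF hν.le hper hτ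
  have hmEpos : 0 < meanEnergy u := by
    by_contra h0
    have : meanEnergy u = 0 := le_antisymm (not_lt.1 h0) hmE
    rw [this, mul_zero] at hpow
    nlinarith
  have hEpos : 0 < E := hmEpos.trans_le hEu
  have h1 : ε ^ 2 / E ≤ ∫ x, ‖force S c x‖ ^ 2 := by
    rw [div_le_iff₀ hEpos]
    exact hpow.trans (mul_le_mul_of_nonneg_left hEu hA)
  -- viscous remainder `|ν τ⁻¹∫∫⟪u,Δf_c⟫| ≤ (ν/2)(E + Λ₂²)`
  have he_st : Torus.IsSmoothSpaceTimeOn univ (fun t x => ‖u t x‖ ^ 2) := by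
    change ContDiffOn ℝ _ (fun z => ‖Torus.stLift u z‖ ^ 2) _
    exact hu.norm_sq ℝ
  have he_cont : Continuous fun t => ∫ x, ‖u t x‖ ^ 2 :=
    continuousOn_univ.1 (he_st.continuousOn_integral convex_univ)
  set L : ℝ := ∫ x, ‖Torus.laplacian (force S c) x‖ ^ 2 with hL_def
  have hL : L ≤ lapBound S c ^ 2 := integral_norm_sq_laplacian_force_le S c
  have hlap_pt : ∀ t, |∫ x, ⟪u t x, Torus.laplacian (force S c) x⟫_ℝ| ≤ ((∫ x, ‖u t x‖ ^ 2) + L) / 2 := by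
    intro t
    have hut : Torus.IsSmooth (u t) := hu.isSmooth_slice (mem_univ t)
    have hint : Integrable (fun x => (‖u t x‖ ^ 2 + ‖Torus.laplacian (force S c) x‖ ^ 2) / 2) :=
      (hut.norm_sq.integrable.add hF.laplacian.norm_sq.integrable).div_const 2
    have hb := norm_integral_le_of_norm_le hint (ae_of_all _ fun x =>
      show ‖⟪u t x, Torus.laplacian (force S c) x⟫_ℝ‖ ≤ (‖u t x‖ ^ 2 + ‖Torus.laplacian (force S c) x‖ ^ 2) / 2 from by
        rw [Real.norm_eq_abs]
        calc |⟪u t x, Torus.laplacian (force S c) x⟫_ℝ| ≤ ‖u t x‖ * ‖Torus.laplacian (force S c) x‖ :=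
              abs_real_inner_le_norm _ _
          _ ≤ (‖u t x‖ ^ 2 + ‖Torus.laplacian (force S c) x‖ ^ 2) / 2 := by
              nlinarith [sq_nonneg (‖u t x‖ - ‖Torus.laplacian (force S c) x‖)])
    rw [Real.norm_eq_abs, integral_div, integral_add hut.norm_sq.integrable hF.laplacian.norm_sq.integrable] at hb
    exact hb
  have hlap_time : |∫ t in (0 : ℝ)..τ, ∫ x, ⟪u t x, Torus.laplacian (force S c) x⟫_ℝ| ≤
      ((∫ t in (0 : ℝ)..τ, ∫ x, ‖u t x‖ ^ 2) + τ * L) / 2 := by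
    have := intervalIntegral.norm_integral_le_of_norm_le hτ.le
      (ae_of_all _ fun t _ => (Real.norm_eq_abs _).trans_le (hlap_pt t))
      (((he_cont.add continuous_const).div_const 2).intervalIntegrable (μ := volume) 0 τ)
    rw [Real.norm_eq_abs] at this
    refine this.trans_eq ?_
    rw [intervalIntegral.integral_div, intervalIntegral.integral_add (he_cont.intervalIntegrable _ _)
      intervalIntegrable_const, intervalIntegral.integral_const, sub_zero, smul_eq_mul]
  have hE : meanEnergy u = τ⁻¹ * ∫ t in (0 : ℝ)..τ, ∫ x, ‖u t x‖ ^ 2 := meanEnergy_eq_period_mean hper hτ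
  have hrem : |ν * (τ⁻¹ * ∫ t in (0 : ℝ)..τ, ∫ x, ⟪u t x, Torus.laplacian (force S c) x⟫_ℝ)| ≤
      ν / 2 * (E + lapBound S c ^ 2) := by
    rw [abs_mul, abs_of_pos hν, abs_mul, abs_of_pos (inv_pos.2 hτ)]
    have hτinv : 0 < τ⁻¹ := inv_pos.2 hτ
    calc ν * (τ⁻¹ * |∫ t in (0 : ℝ)..τ, ∫ x, ⟪u t x, Torus.laplacian (force S c) x⟫_ℝ|)
        ≤ ν * (τ⁻¹ * (((∫ t in (0 : ℝ)..τ, ∫ x, ‖u t x‖ ^ 2) + τ * L) / 2)) := by gcongr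
      _ = ν / 2 * (meanEnergy u + τ⁻¹ * (τ * L)) := by rw [hE]; ring
      _ = ν / 2 * (meanEnergy u + L) := by rw [← mul_assoc, inv_mul_cancel₀ hτ.ne', one_mul]
      _ ≤ ν / 2 * (E + lapBound S c ^ 2) := by gcongr
  have hid := forceEnergy_eq_reynoldsWork_sub hsol hper hτ
  have habs := neg_abs_le (ν * (τ⁻¹ * ∫ t in (0 : ℝ)..τ, ∫ x, ⟪u t x, Torus.laplacian (force S c) x⟫_ℝ))
  linarith

/-- REYNOLDS-WORK FLOOR ON THE LOUD SET: every `c ∈ LOUD_j(S,E,ε)` (`ε > 0`) has a witness with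
`R ≥ ε²/E - (E + Λ₂(c)²)/(2(j+1))`. -/
theorem exists_reynoldsWork_ge_of_mem_loudSet (hε : 0 < ε) {j : ℕ} (hc : c ∈ loudSet S E ε j) :
    ∃ (ν τ : ℝ) (u : ℝ → (UnitAddTorus (Fin 3)) → (EuclideanSpace ℝ (Fin 3))) (p : ℝ → (UnitAddTorus (Fin 3)) → ℝ), 0 < ν ∧ ν < 1 / ((j : ℝ) + 1) ∧ 0 < τ ∧
      Torus.IsClassicalNSSolutionOn univ ν (fun _ => force S c) u p ∧ Function.Periodic u τ ∧
      ε ^ 2 / E - (E + lapBound S c ^ 2) / (2 * ((j : ℝ) + 1)) ≤ reynoldsWork S c τ u := by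
  obtain ⟨ν, hν, hνj, τ, u, p, hτ, hsol, hper, hEu, hεu⟩ := hc
  refine ⟨ν, τ, u, p, hν, hνj, hτ, hsol, hper, ?_⟩
  have h := reynoldsWork_ge hsol hν hper hτ hε hEu hεu
  have hE : 0 ≤ E := (meanEnergy_nonneg' hper hτ).trans hEu
  have hj : (0 : ℝ) < (j : ℝ) + 1 := by positivity
  have h2 : ν / 2 * (E + lapBound S c ^ 2) ≤ (E + lapBound S c ^ 2) / (2 * ((j : ℝ) + 1)) := by
    rw [div_mul_eq_mul_div, div_le_div_iff₀ two_pos (by positivity)]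
    have h3 : ν * ((j : ℝ) + 1) ≤ 1 := by
      have := hνj.le; rwa [le_div_iff₀ hj] at this
    have h4 : 0 ≤ E + lapBound S c ^ 2 := by positivity
    calc ν * (E + lapBound S c ^ 2) * (2 * ((j : ℝ) + 1))
        = (ν * ((j : ℝ) + 1)) * (E + lapBound S c ^ 2) * 2 := by ring
      _ ≤ 1 * (E + lapBound S c ^ 2) * 2 := by gcongr
      _ = (E + lapBound S c ^ 2) * 2 := by ring
  linarith

end Anatomy

end Summit.AnomalousDissipation.AnomalousDissipation.Theorems.DenseLoudDesignerForces.Negative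

end
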